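import Mathlib.Analysis.SpecialFunctions.Exponential
import Mathlib.MeasureTheory.Integral.IntervalIntegral.FundThmCalculus
import Mathlib.MeasureTheory.Integral.IntervalIntegral.IntegrationByParts
import Mathlib.Analysis.SpecificLimits.Normed
import Mathlib.Analysis.Calculus.MeanValue
import Mathlib.Analysis.Calculus.Deriv.Shift
import HarnessLib

/-!
# Norm-continuous one-parameter groups in a Banach algebra are exponentials

Topic `Literature/Analysis/OperatorTheory`. The classical theorem (von Neumann 1929 for matrix
groups; Hille–Phillips / Engel–Nagel, *One-Parameter Semigroups for Linear Evolution Equations*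
(2000), Ch. I, Thm. 3.7: "every uniformly continuous one-parameter (semi)group on a Banach space is
of the form `T(t) = e^{tA}` for a bounded operator `A`"), in a unital Banach algebra `A` over `ℝ`:

* `exists_eq_exp_smul_of_continuous` — if `g : ℝ → A` is continuous with `g 0 = 1` and
  `g (s + t) = g s * g t`, then `g t = exp (t • X)` for some `X ∈ A`;
* `hasDerivAt_of_eq_exp_smul`, `generator_unique` — such a `g` is differentiable with
  `g' (t) = g t * X`, and `X` (the **generator**, `= g'(0)`) is unique;
* `commute_generator` — anything commuting with all `g t` commutes with the generator.

Proof (Engel–Nagel I.3.7; von Neumann's trick): `V(δ) = ∫₀^δ g` has `V(δ)/δ → g(0) = 1`, so `V(δ₀)`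
is invertible for small `δ₀ > 0` (Neumann series); `g(t) V(δ₀) = ∫_t^{t+δ₀} g` is differentiable in
`t` (fundamental theorem of calculus), hence so is `g = (∫_t^{t+δ₀} g) V(δ₀)⁻¹`, with
`g' = g X`, `X = (g(δ₀) − 1) V(δ₀)⁻¹`; and `t ↦ g(t) exp(−tX)` has zero derivative, so
`g(t) = exp(tX)`. Used in the tree for the finite-dimensional representations of `SL(2, ℂ)`
(`Literature.Analysis.FunctionSpaces.spin_statistics`).

## References

* K.-J. Engel, R. Nagel, *One-Parameter Semigroups for Linear Evolution Equations*, Springer GTM 194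
  (2000), Ch. I, Thm. 3.7 and its proof. [EngelNagel2000]
* J. von Neumann, *Über die analytischen Eigenschaften von Gruppen linearer Transformationen und ihrer
  Darstellungen*, Math. Z. 30 (1929) 3–42.

## Mathlib

`NormedSpace.exp`, `hasDerivAt_exp_smul_const'`, `exp_add_of_commute`,
`intervalIntegral.integral_hasDerivAt_right` (FTC), `intervalIntegral.integral_comp_add_left`,
`ContinuousLinearMap.intervalIntegral_comp_comm`, `Units.oneSub` (Neumann series),
`is_const_of_deriv_eq_zero`. Mathlib has the generator theory of strongly continuous semigroups
neither in this bounded form nor otherwise (searched `one-parameter`, `semigroup generator`,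
`uniformly continuous group`: no hits).
-/

noncomputable section

open Filter Set MeasureTheory intervalIntegral NormedSpace
open _root_.Topology

namespace Literature.Analysis.OperatorTheory

variable {A : Type*} [NormedRing A] [NormedAlgebra ℝ A] [CompleteSpace A]

/-! ### Differentiability of `t ↦ exp (t • X)` and uniqueness of the generator -/

/-- `t ↦ exp (t X)` is a one-parameter group: `exp ((s + t) X) = exp (s X) exp (t X)`. [folklore] -/
theorem exp_add_smul [NormedAlgebra ℚ A] (X : A) (s t : ℝ) : exp ((s + t) • X) = exp (s • X) * exp (t • X) := by
  rw [add_smul]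
  exact exp_add_of_commute (((Commute.refl X).smul_left s).smul_right t)

/-- **The generator is the derivative at `0`**: if `g t = exp (t X)` for all `t` then
`g' (t) = g t * X`. [cite: EngelNagel2000, Ch. I Thm 3.7] -/
theorem hasDerivAt_of_eq_exp_smul {g : ℝ → A} {X : A} (h : ∀ t, g t = exp (t • X)) (t : ℝ) :
    HasDerivAt g (g t * X) t := by
  have hfun : g = fun u : ℝ => exp (u • X) := funext h
  rw [hfun]
  exact hasDerivAt_exp_smul_const X t

/-- **Uniqueness of the generator**: if `exp (t X) = exp (t X')` for all real `t` then `X = X'`.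
[cite: EngelNagel2000, Ch. I Thm 3.7] -/
theorem generator_unique {X X' : A} (h : ∀ t : ℝ, exp (t • X) = exp (t • X')) : X = X' := by
  have h1 : HasDerivAt (fun u : ℝ => exp (u • X)) (exp ((0 : ℝ) • X) * X) 0 := hasDerivAt_exp_smul_const X 0
  have h2 : HasDerivAt (fun u : ℝ => exp (u • X)) (exp ((0 : ℝ) • X') * X') 0 := by
    rw [show (fun u : ℝ => exp (u • X)) = fun u : ℝ => exp (u • X') from funext h]
    exact hasDerivAt_exp_smul_const X' 0
  have h3 := h1.unique h2
  simpa using h3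

/-- **The commutant passes to the generator**: if `B` commutes with `exp (t X)` for all real `t`,
then `B` commutes with `X`. [folklore] -/
theorem commute_generator {X B : A} (h : ∀ t : ℝ, Commute B (exp (t • X))) : Commute B X := by
  have h1 : HasDerivAt (fun u : ℝ => B * exp (u • X)) (B * (exp ((0 : ℝ) • X) * X)) 0 :=
    (hasDerivAt_exp_smul_const X 0).const_mul B
  have h2 : HasDerivAt (fun u : ℝ => exp (u • X) * B) (exp ((0 : ℝ) • X) * X * B) 0 :=
    (hasDerivAt_exp_smul_const X 0).mul_const B
  have hfun : (fun u : ℝ => B * exp (u • X)) = fun u : ℝ => exp (u • X) * B := funext fun u => (h u).eq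
  rw [hfun] at h1
  have h3 := h2.unique h1
  simp only [zero_smul, exp_zero, one_mul] at h3
  exact (h3.symm : B * X = X * B)

/-! ### von Neumann's theorem -/

section VonNeumann

variable {g : ℝ → A}

/-- The integrated group `V(δ) = ∫₀^δ g`. [cite: EngelNagel2000, Ch. I Thm 3.7] -/
private def V (g : ℝ → A) (δ : ℝ) : A := ∫ s in (0 : ℝ)..δ, g s

/-- `V' = g` (fundamental theorem of calculus). [folklore] -/
private theorem hasDerivAt_V (hg : Continuous g) (δ : ℝ) : HasDerivAt (V g) (g δ) δ :=
  integral_hasDerivAt_right (hg.intervalIntegrable _ _) (hg.stronglyMeasurableAtFilter _ _) hg.continuousAt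

/-- For small `δ₀ > 0`, `V(δ₀)` is invertible: `V(δ)/δ → g 0 = 1` (Neumann series).
[cite: EngelNagel2000, Ch. I Thm 3.7] -/
private theorem exists_isUnit_V (hg : Continuous g) (h0 : g 0 = 1) :
    ∃ δ₀ : ℝ, 0 < δ₀ ∧ IsUnit (V g δ₀) := by
  have hd := hasDerivAt_V hg 0
  rw [h0, hasDerivAt_iff_tendsto_slope_zero] at hd
  have hV0 : V g 0 = 0 := by simp [V]
  simp only [zero_add, hV0, sub_zero] at hd
  have hev : ∀ᶠ δ in 𝓝[≠] (0 : ℝ), ‖δ⁻¹ • V g δ - 1‖ < 1 := by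
    have := hd (Metric.ball_mem_nhds (1 : A) one_pos)
    filter_upwards [this] with δ hδ
    rwa [mem_preimage, Metric.mem_ball, dist_eq_norm] at hδ
  have hev' : ∀ᶠ δ in 𝓝[>] (0 : ℝ), ‖δ⁻¹ • V g δ - 1‖ < 1 :=
    nhdsWithin_mono _ (fun x hx => ne_of_gt hx) hev
  obtain ⟨δ₀, hδ₀, hpos⟩ := (hev'.and self_mem_nhdsWithin).exists
  refine ⟨δ₀, hpos, ?_⟩
  -- `a = δ₀⁻¹ V(δ₀)` is within `1` of `1`, hence a unit
  set a : A := δ₀⁻¹ • V g δ₀ with ha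
  have hunit : IsUnit a := by
    have h1 : ‖1 - a‖ < 1 := by rwa [norm_sub_rev]
    have h2 : a = 1 - (1 - a) := by abel
    rw [h2]
    exact (Units.oneSub (1 - a) h1).isUnit
  have hVa : V g δ₀ = δ₀ • a := by
    rw [ha, smul_smul, mul_inv_cancel₀ hpos.ne', one_smul]
  rw [hVa]
  obtain ⟨u, hu⟩ := hunit
  refine ⟨⟨δ₀ • a, δ₀⁻¹ • (↑u⁻¹ : A), ?_, ?_⟩, rfl⟩
  · rw [smul_mul_smul_comm, mul_inv_cancel₀ hpos.ne', one_smul, ← hu, Units.mul_inv]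
  · rw [smul_mul_smul_comm, inv_mul_cancel₀ hpos.ne', one_smul, ← hu, Units.inv_mul]

/-- `g(t) V(δ) = ∫_t^{t+δ} g` (the group law under the integral).
[cite: EngelNagel2000, Ch. I Thm 3.7] -/
private theorem mul_V_eq (hg : Continuous g) (hmul : ∀ s t, g (s + t) = g s * g t) (t δ : ℝ) :
    g t * V g δ = V g (δ + t) - V g t := by
  have h1 : g t * V g δ = ∫ s in (0 : ℝ)..δ, g t * g s :=
    (((ContinuousLinearMap.mul ℝ A) (g t)).intervalIntegral_comp_comm (hg.intervalIntegrable _ _)).symm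
  have h2 : (∫ s in (0 : ℝ)..δ, g t * g s) = ∫ s in (0 : ℝ)..δ, g (t + s) :=
    integral_congr fun s _ => (hmul t s).symm
  rw [h1, h2, intervalIntegral.integral_comp_add_left, add_zero, add_comm t δ, V, V,
    integral_interval_sub_left (hg.intervalIntegrable _ _) (hg.intervalIntegrable _ _)]

/-- **Norm-continuous one-parameter groups are exponentials** (von Neumann 1929; Engel–Nagel
(2000), Ch. I, Thm. 3.7): a continuous `g : ℝ → A` into a Banach algebra with `g 0 = 1` and
`g (s + t) = g s * g t` is `g t = exp (t X)` for a (unique, `generator_unique`) `X ∈ A`.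
[cite: EngelNagel2000, Ch. I Thm 3.7] -/
theorem exists_eq_exp_smul_of_continuous [NormedAlgebra ℚ A] (hg : Continuous g) (h0 : g 0 = 1)
    (hmul : ∀ s t, g (s + t) = g s * g t) : ∃ X : A, ∀ t, g t = exp (t • X) := by
  obtain ⟨δ₀, hδ₀, ⟨u, hu⟩⟩ := exists_isUnit_V hg h0
  -- `g t = (V (t + δ₀) - V t) * u⁻¹` is differentiable with `g' = g * X`
  set X : A := (g δ₀ - 1) * (↑u⁻¹ : A) with hX
  have hg_eq : ∀ t, g t = (V g (δ₀ + t) - V g t) * (↑u⁻¹ : A) := fun t => by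
    rw [← mul_V_eq hg hmul, ← hu, mul_assoc, Units.mul_inv, mul_one]
  have hderiv : ∀ t, HasDerivAt g (g t * X) t := by
    intro t
    have h1 : HasDerivAt (fun t => V g (δ₀ + t) - V g t) (g (δ₀ + t) - g t) t :=
      (HasDerivAt.comp_const_add δ₀ t (hasDerivAt_V hg (δ₀ + t))).sub (hasDerivAt_V hg t)
    have h2 := h1.mul_const (↑u⁻¹ : A)
    have hfun : (fun t => (V g (δ₀ + t) - V g t) * (↑u⁻¹ : A)) = g := (funext hg_eq).symm
    rw [hfun] at h2
    convert h2 using 1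
    rw [hX, ← mul_assoc, mul_sub, mul_one, add_comm δ₀ t, hmul]
  -- `t ↦ g t * exp (-t X)` is constant
  set φ : ℝ → A := fun t => g t * exp (t • (-X)) with hφ
  have hφd : ∀ t, HasDerivAt φ 0 t := by
    intro t
    have h1 : HasDerivAt φ (g t * X * exp (t • -X) + g t * (-X * exp (t • -X))) t :=
      (hderiv t).mul (hasDerivAt_exp_smul_const' (-X) t)
    have h0 : g t * X * exp (t • -X) + g t * (-X * exp (t • -X)) = 0 := by noncomm_ring
    rwa [h0] at h1
  have hφc : ∀ t, φ t = 1 := by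
    intro t
    have hc := is_const_of_deriv_eq_zero (fun t => (hφd t).differentiableAt) (fun t => (hφd t).deriv) t 0
    rw [hc]; simp [hφ, h0]
  refine ⟨X, fun t => ?_⟩
  have hinv : exp (t • (-X)) * exp (t • X) = 1 := by
    rw [← exp_add_of_commute (((Commute.refl X).neg_left.smul_left t).smul_right t), smul_neg,
      neg_add_cancel, exp_zero]
  calc g t = g t * (exp (t • (-X)) * exp (t • X)) := by rw [hinv, mul_one]
    _ = φ t * exp (t • X) := by rw [hφ, mul_assoc]
    _ = exp (t • X) := by rw [hφc, one_mul]

end VonNeumann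

end Literature.Analysis.OperatorTheory
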